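import Summits.CriticalPhenomena.SAWScalingLimit.Theorems.SAWLoopFugacityFlowAvoidanceLimitShieldWinding
import Summits.CriticalPhenomena.SAWScalingLimit.Theorems.SAWLoopFugacityFlowAvoidanceLimitShieldLoop
import Literature.Probability.LatticeModels.GermRegionLattice
import Literature.Probability.LatticeModels.AnnulusManeuver
import Literature.Probability.Percolation.BoxCrossingProofs
import Literature.Probability.LatticeModels.InnerFacesHoleFree
import HarnessLib

/-!
# The certified component of the shielding lemma

Sub-problem `CriticalPhenomena/SAWScalingLimit`, crux `AvoidanceLimit`, line `symplectic-fermion-anchor`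
(lead c5, §shield). Let `λ` be a closed walk of the discrete domain graph `Ω^δ` of a Jordan domain
`D` (the loop `In · γ · Far · L̂⁻¹` of the shielding lemma), all of whose vertices are sites of
`Ω_δ`, and let the maneuver box `mW c k` (read at mesh `δ`) miss the germ gate. Call a site
**certified** if it is off `λ`, the polygon of `λ` winds a nonzero number of times about it, it
lies in the box and it is a germ site. Then (`certified_package`):

* every lattice edge at a certified site is an edge of `Ω^δ` (the closed edge lies in the union of
  `D` (rescaled) and the polygon — `segment_subset_of_walkWinding_ne_zero` with the vanishing of the
  winding number off `D`, `wind_walkPath_sub_eq_zero_of_smul_not_mem` — so it is a mesh edge, and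
  its far end is a site of `Ω_δ`);
* a lattice neighbour, inside the box, of a certified site is certified or a vertex of `λ` (the
  winding number does not change across a non-edge, `walkWinding_eq_of_adj_of_closed`; the closed
  edge between two sites off `λ` misses the polygon, `segment_disjoint_range_walkPath_of_adj`, so it
  lies in `D` minus the gate and its far end stays in the germ region).

This is the set `S` fed to the lattice core `shieldCore_*`. All statements are [folklore].
-/

noncomputable section

open scoped BigOperators Classical
open Set Complex SimpleGraph Metric
open Literature.Topology.PlaneTopology
open Literature.Probability.Percolation (walkWinding StepKind stepKind_of_adj)
open Literature.Probability.LatticeModels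
open Literature.Probability.RandomPlanarGeometry (JordanDomain)

namespace Summit.CriticalPhenomena.SAWScalingLimit.Theorems.AvoidanceLimit.Anchor

/-! ### Lattice geometry: an edge between two sites off a walk misses its polygon -/

/-- **The lattice points within distance `< 1` of a closed unit lattice edge are its two ends.** [folklore] -/
theorem eq_or_eq_of_norm_sub_lt_one {v w x : Site 2} (hvw : (zdGraph 2).Adj v w) {z : ℂ}
    (hz : z ∈ segment ℝ (Site.toComplex v) (Site.toComplex w)) (hx : ‖z - Site.toComplex x‖ < 1) :
    x = v ∨ x = w := by
  obtain ⟨t, ht0, ht1, hre, him⟩ := exists_of_mem_segment hz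
  simp only [toComplex_re_im] at hre him
  have h0 : |z.re - (x 0 : ℝ)| < 1 := by
    have := abs_re_le_norm (z - Site.toComplex x)
    simp only [Complex.sub_re, toComplex_re_im] at this
    exact lt_of_le_of_lt this hx
  have h1 : |z.im - (x 1 : ℝ)| < 1 := by
    have := abs_im_le_norm (z - Site.toComplex x)
    simp only [Complex.sub_im, toComplex_re_im] at this
    exact lt_of_le_of_lt this hx
  rw [abs_lt] at h0 h1
  have site_ext : ∀ {p q : Site 2}, p 0 = q 0 → p 1 = q 1 → p = q :=
    fun e0 e1 => by funext i; fin_cases i <;> assumption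
  -- an integer within distance `< 1` of `n + t s`, `t ∈ [0,1]`, `s = ±1`, is `n` or `n + s`;
  -- an integer within distance `< 1` of the integer `n` is `n`
  have near_int : ∀ (n m : ℤ), -1 < (n : ℝ) - m → (n : ℝ) - m < 1 → m = n := by
    intro n m ha hb
    have ha' : m < n + 1 := by exact_mod_cast (by linarith : (m : ℝ) < n + 1)
    have hb' : n < m + 1 := by exact_mod_cast (by linarith : (n : ℝ) < m + 1)
    omega
  have near_step : ∀ (n m : ℤ), -1 < (n : ℝ) + t - m → (n : ℝ) + t - m < 1 → m = n ∨ m = n + 1 := by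
    intro n m ha hb
    have ha' : m < n + 2 := by exact_mod_cast (by linarith : (m : ℝ) < n + 2)
    have hb' : n - 1 < m := by exact_mod_cast (by linarith : (n : ℝ) - 1 < m)
    omega
  have near_step' : ∀ (n m : ℤ), -1 < (n : ℝ) - t - m → (n : ℝ) - t - m < 1 → m = n ∨ m = n - 1 := by
    intro n m ha hb
    have ha' : m < n + 1 := by exact_mod_cast (by linarith : (m : ℝ) < n + 1)
    have hb' : n - 2 < m := by exact_mod_cast (by linarith : (n : ℝ) - 2 < m)
    omega
  rcases stepKind_of_adj hvw with ⟨e0, e1⟩ | ⟨e0, e1⟩ | ⟨e1, e0⟩ | ⟨e1, e0⟩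
  · -- `w = v + e₀`
    rw [e0] at hre; rw [e1] at him; push_cast at hre him
    have hx1 : x 1 = v 1 := near_int (v 1) (x 1) (by rw [him] at h1; linarith [h1.1]) (by rw [him] at h1; linarith [h1.2])
    rcases near_step (v 0) (x 0) (by rw [hre] at h0; linarith [h0.1]) (by rw [hre] at h0; linarith [h0.2]) with hx0 | hx0
    · exact Or.inl (site_ext hx0 hx1)
    · exact Or.inr (site_ext (by rw [hx0, e0]) (by rw [hx1, e1]))
  · -- `v = w + e₀`
    have hw0 : (w 0 : ℝ) = v 0 - 1 := by
      have : v 0 = w 0 + 1 := e0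
      push_cast [this]; ring
    rw [hw0] at hre; rw [e1] at him
    have hre' : z.re = v 0 - t := by rw [hre]; ring
    have hx1 : x 1 = v 1 :=
      near_int (v 1) (x 1) (by rw [him] at h1; linarith [h1.1]) (by rw [him] at h1; linarith [h1.2])
    rcases near_step' (v 0) (x 0) (by rw [hre'] at h0; linarith [h0.1]) (by rw [hre'] at h0; linarith [h0.2]) with hx0 | hx0
    · exact Or.inl (site_ext hx0 hx1)
    · exact Or.inr (site_ext (by omega) (by rw [hx1]; exact e1.symm))
  · -- `w = v + e₁`
    rw [e0] at hre; rw [e1] at him; push_cast at hre him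
    have hx0 : x 0 = v 0 := near_int (v 0) (x 0) (by rw [hre] at h0; linarith [h0.1]) (by rw [hre] at h0; linarith [h0.2])
    rcases near_step (v 1) (x 1) (by rw [him] at h1; linarith [h1.1]) (by rw [him] at h1; linarith [h1.2]) with hx1 | hx1
    · exact Or.inl (site_ext hx0 hx1)
    · exact Or.inr (site_ext (by rw [hx0, e0]) (by rw [hx1, e1]))
  · -- `v = w + e₁`
    have hw1 : (w 1 : ℝ) = v 1 - 1 := by
      have : v 1 = w 1 + 1 := e1
      push_cast [this]; ring
    rw [hw1] at him; rw [e0] at hre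
    have him' : z.im = v 1 - t := by rw [him]; ring
    have hx0 : x 0 = v 0 :=
      near_int (v 0) (x 0) (by rw [hre] at h0; linarith [h0.1]) (by rw [hre] at h0; linarith [h0.2])
    rcases near_step' (v 1) (x 1) (by rw [him'] at h1; linarith [h1.1]) (by rw [him'] at h1; linarith [h1.2]) with hx1 | hx1
    · exact Or.inl (site_ext hx0 hx1)
    · exact Or.inr (site_ext (by rw [hx0]; exact e0.symm) (by omega))

/-- **A closed lattice edge between two sites off a lattice walk misses the polygon of the walk.**
A common point would lie on a unit segment of the polygon, within distance `1/2` of one of its two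
ends (`exists_norm_sub_le_half_of_mem_segment`), which would then be an end of the edge
(`eq_or_eq_of_norm_sub_lt_one`), i.e. a site off the walk — impossible. [folklore] -/
theorem segment_disjoint_range_walkPath_of_adj :
    ∀ {a b : Site 2} (p : (zdGraph 2).Walk a b) (v w : Site 2), (zdGraph 2).Adj v w →
      v ∉ p.support → w ∉ p.support →
      ∀ z ∈ segment ℝ (Site.toComplex v) (Site.toComplex w), z ∉ range (walkPath p) := by
  intro a b p v w hvw hv hw z hz hzp
  obtain ⟨x, hx, y, hy, hxy, hzxy⟩ := exists_mem_segment_of_mem_range_walkPath p hzp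
  rcases exists_norm_sub_le_half_of_mem_segment hxy hzxy with h | h
  · rcases eq_or_eq_of_norm_sub_lt_one hvw hz (lt_of_le_of_lt h (by norm_num)) with rfl | rfl
    exacts [hv hx, hw hx]
  · rcases eq_or_eq_of_norm_sub_lt_one hvw hz (lt_of_le_of_lt h (by norm_num)) with rfl | rfl
    exacts [hv hy, hw hy]

/-! ### The four lattice directions -/

/-- Every step vector of `SRW.Dir 2` is one of the four `cornerUnit` vectors. [folklore] -/
theorem exists_cornerUnit_eq_stepVec (e : SRW.Dir 2) : ∃ kk : Fin 4, cornerUnit kk = SRW.stepVec e := by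
  obtain ⟨i, bb⟩ := e
  fin_cases i <;> cases bb
  · exact ⟨2, by simp [SRW.stepVec, cornerUnit]⟩
  · exact ⟨0, by simp [SRW.stepVec, cornerUnit]⟩
  · exact ⟨3, by simp [SRW.stepVec, cornerUnit]⟩
  · exact ⟨1, by simp [SRW.stepVec, cornerUnit]⟩

/-- The mesh segment is the rescaled lattice segment. [folklore] -/
theorem mem_segment_meshPoint_iff (δ : ℝ) (x y : Site 2) (Y : ℂ) :
    Y ∈ segment ℝ (meshPoint δ x) (meshPoint δ y) ↔
      ∃ z ∈ segment ℝ (Site.toComplex x) (Site.toComplex y), Y = (δ : ℂ) * z := by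
  constructor
  · intro hY
    rw [segment_eq_image_lineMap] at hY
    obtain ⟨t, ht, rfl⟩ := hY
    refine ⟨AffineMap.lineMap (Site.toComplex x) (Site.toComplex y) t, ?_, ?_⟩
    · rw [segment_eq_image_lineMap]; exact ⟨t, ht, rfl⟩
    · simp only [meshPoint, AffineMap.lineMap_apply_module, Complex.real_smul]; ring
  · rintro ⟨z, hz, rfl⟩
    rw [segment_eq_image_lineMap] at hz ⊢
    obtain ⟨t, ht, rfl⟩ := hz
    refine ⟨t, ht, ?_⟩
    simp only [meshPoint, AffineMap.lineMap_apply_module, Complex.real_smul]; ring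

/-! ### The certified sites -/

/-- **The certified sites of the shielding lemma.** Let `λ` be a closed walk of
`Ω^δ = discreteDomainGraph D.carrier δ` (`D` a Jordan domain, `δ > 0`) all of whose vertices are
sites of `Ω_δ`, and suppose the germ gate stays outside the mesh box of sup-radius `(48k+2)δ` about
`δ c`. Let `S` be the set of sites `v` off `λ` with `walkWinding λ v ≠ 0`, in the box `mW c k`, that
are germ sites. Then every lattice edge at a site of `S` is an edge of `Ω^δ`, and a lattice
neighbour inside the box of a site of `S` lies in `S` or on `λ`. [folklore] -/
theorem certified_package :
    ∀ (D : JordanDomain) (b : ℂ) (s : ℝ) (hs : 0 < s) (g o : ℂ) (δ : ℝ), 0 < δ →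
    ∀ {a : Site 2} (lam : (discreteDomainGraph D.carrier δ).Walk a a) (c : Site 2) (k : ℕ),
      (∀ t ∈ lam.support, t ∈ meshDomain D.carrier δ) →
      (∀ z ∈ germGate D b hs g o, (48 * k + 2) * δ < |z.re - δ * c 0| ∨ (48 * k + 2) * δ < |z.im - δ * c 1|) →
      ∃ S : Set (Site 2),
        (∀ u : Site 2, u ∉ lam.support →
          walkWinding (lam.mapLe ((discreteDomainGraph_le_meshGraph _ _).trans (meshGraph_le_zdGraph _ _))) u ≠ 0 →
          u ∈ mW c k → u ∈ germSites D b hs g o δ → u ∈ S) ∧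
        S ⊆ germSites D b hs g o δ ∧ S ⊆ mW c k ∧ (∀ v ∈ S, v ∉ lam.support) ∧
        (∀ v ∈ S, ∀ e : SRW.Dir 2, (discreteDomainGraph D.carrier δ).Adj v (v + SRW.stepVec e)) ∧
        (∀ v ∈ S, ∀ kk : Fin 4, v + cornerUnit kk ∈ mW c k →
          v + cornerUnit kk ∈ S ∨ v + cornerUnit kk ∈ lam.support) := by
  intro D b s hs g o δ hδ a lam c k hlam hgate
  have hle : discreteDomainGraph D.carrier δ ≤ zdGraph 2 :=
    (discreteDomainGraph_le_meshGraph _ _).trans (meshGraph_le_zdGraph _ _)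
  set lam' := lam.mapLe hle with hlam'
  have hsupp : lam'.support = lam.support := Walk.support_mapLe_eq_support hle lam
  -- the rescaled polygon lies in the closure of `D`
  have ha : meshPoint δ a ∈ closure D.carrier :=
    subset_closure (meshDomain_subset_meshVertices _ _ (hlam a (Walk.start_mem_support lam)))
  have hpoly : ∀ z ∈ range (walkPath lam'), (δ : ℂ) * z ∈ closure D.carrier := by
    rw [hlam', walkPath_mapLe]
    exact smul_mem_closure_of_mem_range_walkPath D.carrier δ lam ha
  set K : Set ℂ := {q : ℂ | (δ : ℂ) * q ∉ D.carrier} with hK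
  have hKwind : ∀ q ∈ K, q ∉ range (walkPath lam') → wind (fun t => (walkPath lam').extend t - q) = 0 :=
    fun q hq hqr => wind_walkPath_sub_eq_zero_of_smul_not_mem D δ hδ lam' hpoly q hq hqr
  -- the set
  refine ⟨{v | v ∉ lam.support ∧ walkWinding lam' v ≠ 0 ∧ v ∈ mW c k ∧ v ∈ germSites D b hs g o δ},
    fun u hu hw huW huΘ => ⟨hu, hw, huW, huΘ⟩, fun v hv => hv.2.2.2, fun v hv => hv.2.2.1, fun v hv => hv.1, ?_, ?_⟩
  · -- every lattice edge at a certified site is an edge of `Ω^δ`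
    intro v hv e
    obtain ⟨hvs, hvw, hvW, hvΘ⟩ := hv
    obtain ⟨kk, hkk⟩ := exists_cornerUnit_eq_stepVec e
    rw [← hkk]
    have hvs' : v ∉ lam'.support := by rwa [hsupp]
    have hseg := segment_subset_of_walkWinding_ne_zero K lam' hKwind v hvs' hvw kk
    -- the mesh segment lies in the closure
    have hsegcl : segment ℝ (meshPoint δ v) (meshPoint δ (v + cornerUnit kk)) ⊆ closure D.carrier := by
      intro Y hY
      obtain ⟨z, hz, rfl⟩ := (mem_segment_meshPoint_iff δ _ _ Y).1 hY
      rcases hseg hz with h | h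
      · rw [hK, mem_compl_iff, mem_setOf_eq, not_not] at h
        exact subset_closure h
      · exact hpoly z h
    have hmesh : (meshGraph D.carrier δ).Adj v (v + cornerUnit kk) :=
      meshGraph_adj_iff.2 ⟨zdGraph_adj_add_cornerUnit v kk, hsegcl⟩
    -- the far end is a site of `Ω_δ`
    have hwD : v + cornerUnit kk ∈ meshDomain D.carrier δ := by
      by_cases hws : v + cornerUnit kk ∈ lam.support
      · exact hlam _ hws
      · have hws' : v + cornerUnit kk ∉ lam'.support := by rwa [hsupp]
        have hpt : Site.toComplex (v + cornerUnit kk) ∈ Kᶜ := by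
          rcases hseg (right_mem_segment _ _ _) with h | h
          · exact h
          · exact absurd h (toComplex_not_mem_range_walkPath lam' hws')
        rw [hK, mem_compl_iff, mem_setOf_eq, not_not] at hpt
        exact Literature.Probability.Percolation.mem_meshDomain_of_meshGraph_adj hvΘ.1 hpt hmesh
    exact discreteDomainGraph_adj_iff.2 ⟨hmesh, hvΘ.1, hwD⟩
  · -- a lattice neighbour inside the box is certified or on the loop
    intro v hv kk hwW
    obtain ⟨hvs, hvw, hvW, hvΘ⟩ := hv
    by_cases hws : v + cornerUnit kk ∈ lam.support
    · exact Or.inr hws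
    left
    have hvs' : v ∉ lam'.support := by rwa [hsupp]
    have hws' : v + cornerUnit kk ∉ lam'.support := by rwa [hsupp]
    have hadj := zdGraph_adj_add_cornerUnit v kk
    have hww : walkWinding lam' (v + cornerUnit kk) ≠ 0 := by
      rw [← walkWinding_eq_of_adj_of_closed lam' v _ hadj hvs' hws']; exact hvw
    have hseg := segment_subset_of_walkWinding_ne_zero K lam' hKwind v hvs' hvw kk
    -- the closed edge misses the polygon, hence lies (rescaled) in `D`
    have hsegD : segment ℝ (meshPoint δ v) (meshPoint δ (v + cornerUnit kk)) ⊆ D.carrier := by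
      intro Y hY
      obtain ⟨z, hz, rfl⟩ := (mem_segment_meshPoint_iff δ _ _ Y).1 hY
      rcases hseg hz with h | h
      · rw [hK, mem_compl_iff, mem_setOf_eq, not_not] at h; exact h
      · exact absurd h (segment_disjoint_range_walkPath_of_adj lam' v _ hadj hvs' hws' z hz)
    have hwpt : meshPoint δ (v + cornerUnit kk) ∈ D.carrier := hsegD (right_mem_segment _ _ _)
    have hmesh : (meshGraph D.carrier δ).Adj v (v + cornerUnit kk) :=
      meshGraph_adj_iff.2 ⟨hadj, hsegD.trans subset_closure⟩
    have hwD : v + cornerUnit kk ∈ meshDomain D.carrier δ :=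
      Literature.Probability.Percolation.mem_meshDomain_of_meshGraph_adj hvΘ.1 hwpt hmesh
    -- the closed edge misses the gate (it lies in the box), so its far end stays in the germ region
    have hvW' : |v 0 - c 0| ≤ 48 * k ∧ |v 1 - c 1| ≤ 48 * k := by simpa [mW] using hvW
    have hwW' : |(v + cornerUnit kk) 0 - c 0| ≤ 48 * k ∧ |(v + cornerUnit kk) 1 - c 1| ≤ 48 * k := by
      simpa [mW] using hwW
    have hbox : ∀ Y ∈ segment ℝ (meshPoint δ v) (meshPoint δ (v + cornerUnit kk)),
        |Y.re - δ * c 0| ≤ (48 * k + 2) * δ ∧ |Y.im - δ * c 1| ≤ (48 * k + 2) * δ := by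
      intro Y hY
      obtain ⟨z, hz, rfl⟩ := (mem_segment_meshPoint_iff δ _ _ Y).1 hY
      obtain ⟨t, ht0, ht1, hre, him⟩ := exists_of_mem_segment hz
      simp only [toComplex_re_im] at hre him
      obtain ⟨hv0, hv1⟩ := hvW'
      obtain ⟨hw0, hw1⟩ := hwW'
      rw [abs_le] at hv0 hv1 hw0 hw1
      have hv0' : -(48 * (k : ℝ)) ≤ (v 0 : ℝ) - c 0 ∧ ((v 0 : ℝ) - c 0) ≤ 48 * k := by
        constructor <;> exact_mod_cast (by omega : _) 
      have hv1' : -(48 * (k : ℝ)) ≤ (v 1 : ℝ) - c 1 ∧ ((v 1 : ℝ) - c 1) ≤ 48 * k := by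
        constructor <;> exact_mod_cast (by omega : _)
      have hw0' : -(48 * (k : ℝ)) ≤ ((v + cornerUnit kk) 0 : ℝ) - c 0 ∧ (((v + cornerUnit kk) 0 : ℝ) - c 0) ≤ 48 * k := by
        constructor <;> exact_mod_cast (by omega : _)
      have hw1' : -(48 * (k : ℝ)) ≤ ((v + cornerUnit kk) 1 : ℝ) - c 1 ∧ (((v + cornerUnit kk) 1 : ℝ) - c 1) ≤ 48 * k := by
        constructor <;> exact_mod_cast (by omega : _)
      have hδ' : (0 : ℝ) ≤ δ := hδ.le
      have hzre : |z.re - c 0| ≤ 48 * k := by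
        rw [hre, abs_le]
        constructor <;> nlinarith [mul_nonneg (sub_nonneg.2 ht1) (by linarith [hv0'.1] : (0:ℝ) ≤ (v 0 : ℝ) - c 0 + 48 * k),
          mul_nonneg ht0 (by linarith [hw0'.1] : (0:ℝ) ≤ ((v + cornerUnit kk) 0 : ℝ) - c 0 + 48 * k),
          mul_nonneg (sub_nonneg.2 ht1) (by linarith [hv0'.2] : (0:ℝ) ≤ 48 * k - ((v 0 : ℝ) - c 0)),
          mul_nonneg ht0 (by linarith [hw0'.2] : (0:ℝ) ≤ 48 * k - (((v + cornerUnit kk) 0 : ℝ) - c 0))]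
      have hzim : |z.im - c 1| ≤ 48 * k := by
        rw [him, abs_le]
        constructor <;> nlinarith [mul_nonneg (sub_nonneg.2 ht1) (by linarith [hv1'.1] : (0:ℝ) ≤ (v 1 : ℝ) - c 1 + 48 * k),
          mul_nonneg ht0 (by linarith [hw1'.1] : (0:ℝ) ≤ ((v + cornerUnit kk) 1 : ℝ) - c 1 + 48 * k),
          mul_nonneg (sub_nonneg.2 ht1) (by linarith [hv1'.2] : (0:ℝ) ≤ 48 * k - ((v 1 : ℝ) - c 1)),
          mul_nonneg ht0 (by linarith [hw1'.2] : (0:ℝ) ≤ 48 * k - (((v + cornerUnit kk) 1 : ℝ) - c 1))]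
      constructor
      · have e : ((δ : ℂ) * z).re - δ * c 0 = δ * (z.re - c 0) := by
          rw [Complex.mul_re]; simp; ring
        rw [e, abs_mul, abs_of_nonneg hδ']
        nlinarith [abs_nonneg (z.re - c 0)]
      · have e : ((δ : ℂ) * z).im - δ * c 1 = δ * (z.im - c 1) := by
          rw [Complex.mul_im]; simp; ring
        rw [e, abs_mul, abs_of_nonneg hδ']
        nlinarith [abs_nonneg (z.im - c 1)]
    have hsegG : segment ℝ (meshPoint δ v) (meshPoint δ (v + cornerUnit kk)) ⊆ D.carrier \ germGate D b hs g o := by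
      intro Y hY
      refine ⟨hsegD hY, fun hYg => ?_⟩
      obtain ⟨h1, h2⟩ := hbox Y hY
      rcases hgate Y hYg with h | h <;> linarith
    have hvgerm : meshPoint δ v ∈ germRegion D b hs g o := hvΘ.2
    have hcomp : segment ℝ (meshPoint δ v) (meshPoint δ (v + cornerUnit kk)) ⊆
        connectedComponentIn (D.carrier \ germGate D b hs g o) (meshPoint δ v) :=
      (convex_segment _ _).isPreconnected.subset_connectedComponentIn (left_mem_segment _ _ _) hsegG
    have hgermeq : germRegion D b hs g o = connectedComponentIn (D.carrier \ germGate D b hs g o) (meshPoint δ v) := by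
      show gateSide D (boxJD b hs) g (germGateParam D b hs g o) = _
      rw [gateSide, connectedComponentIn_eq hvgerm]
      rfl
    have hwgerm : meshPoint δ (v + cornerUnit kk) ∈ germRegion D b hs g o := by
      rw [hgermeq]; exact hcomp (right_mem_segment _ _ _)
    exact ⟨hws, hww, hwW, hwD, hwgerm⟩

end Summit.CriticalPhenomena.SAWScalingLimit.Theorems.AvoidanceLimit.Anchor

end
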